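import Literature.NumberTheory.CubicFields.VoronoiChain
import HarnessLib

/-!
# The regulator of a cubic field of signature (1,1) is at most (number of reduced principal ideals) × (largest gap)

Topic `Literature/NumberTheory/CubicFields`; continues `VoronoiChain.lean` (the Voronoi chain of
relative minima of a fractional ideal of a cubic field `K` with one real embedding `σ₁` and a non-real
embedding `σ₂`). The principle behind every bound `R_K = O(√|d_K| · …)` obtained from the
infrastructure (Voronoi 1896; Williams–Dueck–Schmid 1983; Buchmann–Williams 1988, unit rank one):
walking the Voronoi chain `1 = θ₀, θ₁, θ₂, …` of `𝓞 K` from `1`, the LEAST unit `ε` with `σ₁ ε > 1`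
is reached, `θₙ = ε`, and the principal ideals `(θᵢ)`, `0 ≤ i < n`, are PAIRWISE DISTINCT (a
coincidence `(θᵢ) = (θⱼ)`, `i < j < n`, produces the unit `θⱼ/θᵢ` with `1 < σ₁ < σ₁ ε`). Hence

  `log σ₁ ε = Σ_{i<n} log (σ₁ θᵢ₊₁ / σ₁ θᵢ) ≤ n · log G ≤ #{integral ideals of norm ≤ M} · log G`

for any bound `G` on the gaps `σ₁ θᵢ₊₁ / σ₁ θᵢ` and any bound `M` on the norms `|N θ| = |σ₁ θ| ‖σ₂ θ‖²`
of the positive relative minima `θ` of `𝓞 K` — `log_unit_le_ncard_mul_log`. The two analytic inputs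
(`G = 3√|d_K|` and `M = 2√|d_K|/π`, by Minkowski) are in `VoronoiReduction.lean`; they are kept as
hypotheses here so that this file is pure chain combinatorics. Theorem-only file.

## References

* G. Voronoi, *On a generalization of the algorithm of continued fractions* (1896).
* B. N. Delone, D. K. Faddeev, *The theory of irrationalities of the third degree*, Transl. Math.
  Monographs 10, AMS (1964), Ch. IV.
* J. Buchmann, H. C. Williams, *On the infrastructure of the principal ideal class of an algebraic
  number field of unit rank one*, Math. Comp. 50 (1988), §§2–3. [BuchmannWilliams1988Infrastructure]
-/

namespace Literature.NumberTheory.CubicFields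

open scoped NumberField ComplexConjugate nonZeroDivisors
open NumberField

section RegulatorBound

variable {K : Type*} [Field K] [NumberField K] {σ₁ : K →+* ℝ} {σ₂ : K →+* ℂ}
variable (hdeg : Module.finrank ℚ K = 3) (hσ₂ : ∃ z : K, starRingEnd ℂ (σ₂ z) ≠ σ₂ z)
  (ε : (𝓞 K)ˣ) (hε : 1 < σ₁ (algebraMap (𝓞 K) K ε))

include hdeg hσ₂ hε in
/-- **The regulator is at most (number of reduced principal ideals) × (largest gap).** Let `ε` be the
least unit of `𝓞 K` with `σ₁ ε > 1` (so `log σ₁ ε` is the regulator), let `1` be a positive relative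
minimum of `𝓞 K`, let `G ≥ 1` bound the gaps `σ₁ (succ μ) ≤ G σ₁ μ` of the Voronoi chain of `𝓞 K` and
let `M` bound `|σ₁ θ| ‖σ₂ θ‖² = |N θ|` for its positive relative minima `θ`. Then
`log σ₁ ε ≤ #{integral ideals B : 1 ≤ N(B) ≤ ⌊M⌋} · log G`: the chain `1 = θ₀ < θ₁ < ⋯ < θₙ = ε` has
`σ₁ θₙ ≤ Gⁿ`, and `i ↦ (θᵢ)`, `i < n`, is injective into the ideals of norm `≤ M` (a coincidence
`(θᵢ) = (θⱼ)`, `i < j < n`, gives the unit `θⱼ / θᵢ` with `1 < σ₁ (θⱼ/θᵢ) ≤ σ₁ θⱼ < σ₁ ε`). [folklore] -/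
theorem log_unit_le_ncard_mul_log
    (hmin : ∀ u : (𝓞 K)ˣ, 1 < σ₁ (algebraMap (𝓞 K) K u) → σ₁ (algebraMap (𝓞 K) K ε) ≤ σ₁ (algebraMap (𝓞 K) K u))
    (h1 : (1 : K) ∈ posRelMinima σ₁ σ₂ (1 : FractionalIdeal (𝓞 K)⁰ K)) {G M : ℝ} (hG : 1 ≤ G)
    (hgap : ∀ μ ∈ posRelMinima σ₁ σ₂ (1 : FractionalIdeal (𝓞 K)⁰ K),
      σ₁ (voronoiSucc σ₁ σ₂ (1 : FractionalIdeal (𝓞 K)⁰ K) μ) ≤ G * σ₁ μ)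
    (hnorm : ∀ θ ∈ posRelMinima σ₁ σ₂ (1 : FractionalIdeal (𝓞 K)⁰ K), |σ₁ θ| * ‖σ₂ θ‖ ^ 2 ≤ M) :
    Real.log (σ₁ (algebraMap (𝓞 K) K ε)) ≤
      ({B : Ideal (𝓞 K) | 1 ≤ Ideal.absNorm B ∧ Ideal.absNorm B ≤ ⌊M⌋₊}.ncard : ℝ) * Real.log G := by
  classical
  set O : FractionalIdeal (𝓞 K)⁰ K := 1 with hO1
  have hε0 : 0 < σ₁ (algebraMap (𝓞 K) K ε) := by linarith
  have hM : 0 ≤ M := by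
    have h := hnorm 1 h1
    rw [map_one, map_one, abs_one, norm_one, one_pow, one_mul] at h
    linarith
  -- the chain from `1`
  set θ : ℕ → K := fun j => (voronoiSucc σ₁ σ₂ O)^[j] 1 with hθ
  have hθmem : ∀ j, θ j ∈ posRelMinima σ₁ σ₂ O := fun j => iterate_voronoiSucc_mem hdeg hσ₂ ε hε h1 j
  have hθsucc : ∀ j, θ (j + 1) = voronoiSucc σ₁ σ₂ O (θ j) := fun j => by
    simp only [hθ, Function.iterate_succ_apply']
  have hθmono : StrictMono fun j => σ₁ (θ j) := strictMono_nat_of_lt_succ fun j => by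
    rw [hθsucc]; exact (voronoiSucc_spec hdeg hσ₂ ε hε (hθmem j)).2.1
  have hθ0 : θ 0 = 1 := rfl
  -- `ε` is on the chain
  obtain ⟨n, hn⟩ : ∃ n : ℕ, θ n = algebraMap (𝓞 K) K ε := by
    have hεm : algebraMap (𝓞 K) K ε * 1 ∈ posRelMinima σ₁ σ₂ O := unit_mul_mem_posRelMinima h1 ε hε0
    rw [mul_one] at hεm
    exact exists_iterate_voronoiSucc_eq hdeg hσ₂ ε hε h1 hεm (by rw [map_one]; exact hε.le)
  -- the gaps
  have hG0 : 0 ≤ G := by linarith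
  have hgapj : ∀ j, σ₁ (θ j) ≤ G ^ j := by
    intro j
    induction j with
    | zero => simp [hθ0]
    | succ j ih =>
      calc σ₁ (θ (j + 1)) = σ₁ (voronoiSucc σ₁ σ₂ O (θ j)) := by rw [hθsucc]
        _ ≤ G * σ₁ (θ j) := hgap _ (hθmem j)
        _ ≤ G * G ^ j := by gcongr
        _ = G ^ (j + 1) := by ring
  -- the chain elements are algebraic integers
  have hx : ∀ j, ∃ x : 𝓞 K, algebraMap (𝓞 K) K x = θ j := fun j =>
    (FractionalIdeal.mem_one_iff _).mp (hθmem j).1.1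
  choose x hx using hx
  set T : Set (Ideal (𝓞 K)) := {B : Ideal (𝓞 K) | 1 ≤ Ideal.absNorm B ∧ Ideal.absNorm B ≤ ⌊M⌋₊} with hT
  have hTfin : T.Finite := (Ideal.finite_setOf_absNorm_le _).subset fun B hB => hB.2
  have hmaps : ∀ j ∈ ((Finset.range n : Finset ℕ) : Set ℕ), Ideal.span {x j} ∈ T := by
    intro j _
    have hx0 : x j ≠ 0 := fun h => (hθmem j).1.2.1 (by rw [← hx j, h, map_zero])
    refine ⟨Nat.one_le_iff_ne_zero.mpr ?_, ?_⟩
    · rw [Ne, Ideal.absNorm_eq_zero_iff, Ideal.span_singleton_eq_bot]; exact hx0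
    · rw [Nat.le_floor_iff hM, Ideal.absNorm_span_singleton, Nat.cast_natAbs, Int.cast_abs]
      have e : ((Algebra.norm ℤ (x j) : ℤ) : ℝ) = σ₁ (θ j) * ‖σ₂ (θ j)‖ ^ 2 := by
        rw [← norm_eq_mul_norm_sq σ₁ σ₂ hdeg hσ₂ (θ j), ← hx j, ← Algebra.coe_norm_int, Rat.cast_intCast]
      rw [e, abs_mul, abs_of_nonneg (sq_nonneg ‖σ₂ (θ j)‖)]
      exact hnorm _ (hθmem j)
  have hinj : Set.InjOn (fun j => Ideal.span ({x j} : Set (𝓞 K))) ((Finset.range n : Finset ℕ) : Set ℕ) := by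
    have key : ∀ i j, j < n → i < j → Ideal.span ({x i} : Set (𝓞 K)) = Ideal.span {x j} → False := by
      intro i j hj hlt heq
      obtain ⟨u, hu⟩ := Ideal.span_singleton_eq_span_singleton.mp heq
      have hK : θ j = θ i * algebraMap (𝓞 K) K u := by rw [← hx i, ← hx j, ← map_mul, hu]
      have hposi : 0 < σ₁ (θ i) := (hθmem i).2
      have hi1 : 1 ≤ σ₁ (θ i) := by
        have := hθmono.monotone (Nat.zero_le i)
        simpa [hθ0] using this
      have hσu : σ₁ (algebraMap (𝓞 K) K u) * σ₁ (θ i) = σ₁ (θ j) := by rw [hK, map_mul]; ring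
      have hij : σ₁ (θ i) < σ₁ (θ j) := hθmono hlt
      have hu1 : 1 < σ₁ (algebraMap (𝓞 K) K u) := by nlinarith
      have hεu := hmin u hu1
      have hle : σ₁ (θ n) ≤ σ₁ (θ j) := by rw [hn]; nlinarith
      exact absurd (hθmono.le_iff_le.mp hle) (not_le.mpr hj)
    intro i hi j hj hij
    simp only [Finset.coe_range, Set.mem_Iio] at hi hj
    rcases lt_trichotomy i j with h | h | h
    · exact (key i j hj h hij).elim
    · exact h
    · exact (key j i hi h hij.symm).elim
  have hcard := Set.ncard_le_ncard_of_injOn (fun j => Ideal.span ({x j} : Set (𝓞 K))) hmaps hinj hTfin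
  rw [Set.ncard_coe_finset, Finset.card_range] at hcard
  calc Real.log (σ₁ (algebraMap (𝓞 K) K ε)) = Real.log (σ₁ (θ n)) := by rw [hn]
    _ ≤ Real.log (G ^ n) := Real.log_le_log (hθmem n).2 (hgapj n)
    _ = n * Real.log G := Real.log_pow _ _
    _ ≤ (T.ncard : ℝ) * Real.log G :=
        mul_le_mul_of_nonneg_right (by exact_mod_cast hcard) (Real.log_nonneg hG)

end RegulatorBound

end Literature.NumberTheory.CubicFields
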